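import Mathlib
import Summits.Ventures.HodgeRepro0.P1LatticeIndexTwoExactCore2

/-!
# P1LatticeIndexTwoExactCore3 — D13's THEOREM A (proofs/P1-FermatLatticeClosure-v1.2.md l.4, DECLARED STATUS l.4789) at its
INDEX-2 degrees: the «EXACTLY 2» half of the clause «[H_M : L_M] = 2 and 2H_M ⊂ L_M», kernel-checked — THE CORE, PART 3 of 3: the three block lemmas (`par4`, `par6`, `parS`: the checks passed ⇒ χ even on every block), the functional argument on the ℤ-span, the weight-constraint matrix, the augmented certificate lemma and the listed blocks
(pub-hodge-repro0, p1 (g28), 2026-08-30) — the companion of lean/P1LatticeIndexTwoA–F.lean (p1 (g27), STATUS l.11237: the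
containment half 2·H_M ⊆ L_M).

Supporting artefact in the sense of ROUTE.md R-5 (finite combinatorics / exact arithmetic only; never the discharge of a
Hodge-theoretic step; record-only).  THE OBJECTS, as the D13 page defines them (§1 l.7): odd vectors s ∈ ℤ^{⌊(M−1)/2⌋}
(the coordinate a ↔ the pair {a, M − a}, 1 ≤ a ≤ ⌊(M−1)/2⌋; for M even the coordinate M/2 is taken modulo the pair
(M/2, M/2) = 2e_{M/2} ∈ L_M and is NOT a coordinate here); H_M := the integer kernel of the weight constraints
Σₐ sₐ·(2·(t·a mod M) − M) = 0, t a unit mod M; L_M := the ℤ-span of the odd vectors of the LEGITIMATE BLOCKS — here stated as a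
PREDICATE on multisets (`IsBlock`), not a listed set: every Hodge 4-multiset of ℤ/M, every Hodge 6-multiset of ℤ/M that is the
sum of two zero-sum triples, every σ_{p,i} of Aoki's full p-standard set of level M (p an odd prime dividing M, 1 ≤ i < M,
(M/p)/gcd(i, M/p) > 2 — the level-M σ's with gcd(i, M/p) = 1 and the pull-backs of those of every level m′ ∣ M); the pull-backs
and unit translates of the 4- and 6-multisets of the levels m′ ∣ M are such multisets of level M themselves, so this set
contains every block of the page's Lemma 1 (b).  Per degree M the kernel certifies (`decide +kernel`; every number from the
generator's JSON, nothing typed by hand):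
* `units_eq_M` — the listed units are `unitsL M` (the t < M with gcd(t, M) = 1);
* `checkP_M`, `check6_M`, `checkS_M` — a ℤ/2-functional χ_M (`chi_M`, on the coordinates a < M/2) has EVEN value on the odd
  vector of EVERY block: every Hodge 4-multiset through its two sorted pairs — for every sorted pair [a, b] ⊂ [1, M−1] with
  a + b ≢ 0 (mod M) the weights S(u, [a, b]) are ≢ 0 (mod M) and the table `tabP_M`, keyed by M·profile + ((a + b) mod M)
  (the profile = the bits [M < S(u, T)] over the units u < M/2), gives its parity at the key or at the complementary key
  (one of each complementary pair is stored), and the table's parities agree at complementary keys ([a, b] ∗ [c, d] with a + b ≢ 0 is Hodge iff c + d ≡ −(a + b) and the profiles are complementary, Lemma `par4`; the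
  cancelling case a + b ≡ 0 has odd vector 0, Lemma `oddVec_cancel`); every split Hodge 6-multiset through its zero-sum
  triples — for every sorted zero-sum triple T the weights lie in {M, 2M} and the table `tab6_M` keyed by the profile gives
  its parity (at the profile or its complement), the parities agreeing at complementary profiles (T₁ ∗ T₂ is Hodge iff the profiles are complementary, Lemma
  `par6`); every σ_{p,i} by enumeration;
* `witness_hodge_M`, `witness_in_H_M`, `witness_par_M` — an explicit Hodge multiset x_M (`xM_M`) with s(x_M) ∈ H_M and
  χ_M(s(x_M)) ODD — hence `witness_notin_M`: s(x_M) ∉ L_M (the span of the odd vectors of ALL blocks; the functional argument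
  `notin_of_parity`), so [H_M : L_M] ≥ 2 — the «≥» half of Theorem A's «= 2»;
* `blocks_ok_M`, `K_eq_M`, `cert_M`, `ker_sub_M` — every s ∈ H_M with χ_M(s) even is an integer combination of the odd vectors
  of listed legitimate level-M blocks (`blocks_M`, each checked a block): a certificate of the shape d·(1 − K̃ᵀ·W̃) = X̃·B̃ on the
  augmented system B̃ = [[BH_M, 0], [χ_M, −2]] (K̃ a ℤ-basis of its kernel, K̃ projected = C₀·G);
* `index_two_M` — hence H_M ⊓ L_M = H_M ⊓ {s : χ_M(s) even} while s(x_M) ∈ H_M has χ_M odd (`witness_not_le_M`): H_M ⊓ L_M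
  is EXACTLY the index-2 sublattice of H_M cut out by χ_M.  With L_M ⊆ H_M (every block is a Hodge multiset — the page's
  Lemma 1 (b)/(d), not formalised here) this is [H_M : L_M] = 2 on the coordinates a < M/2, i.e. Theorem A's index-2 claim at M
  once the coordinate M/2 is taken modulo 2e_{M/2} (the page's l.7 bookkeeping, as in the index-1 and index-2 artefacts).
NOT formalised: L_M ⊆ H_M; claim(·) for the blocks (Shioda 1981 Thm 4.3 / Lefschetz (1,1), Aoki 1987 Thm 2-1 / Thm 1-4);
anything Hodge-theoretic.  The data were found by gen_i2x.py (own enumeration of every block of the level, the mod-2 row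
space of their odd vectors, a sparse χ in its annihilator with χ(x_M) odd, the profile table, and the certificate by a greedy
tracked echelon over the level-M blocks; K̃ = the deposit routine intlin_local.int_kernel's basis).
Nothing here asserts anything about whether the statement of README §1 has been proved elsewhere.
-/

namespace HodgeRepro0.P1.P1LatticeIndexTwoExact
open Matrix

/-- THE 4-MULTISET LEMMA: the pair check passed (U a list of units) ⇒ every Hodge 4-multiset has even parity -/
theorem par4 {n : ℕ} (M : ℕ) (hM : 3 ≤ M) (hn : n ≤ (M - 1) / 2) (U : List ℕ) (hU : ∀ u ∈ U, u < M ∧ Nat.gcd u M = 1)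
    (sup : List ℕ) (hnd : sup.Nodup) (hlt : ∀ i ∈ sup, i < n) (cs : List (List ℕ)) (h : checkP M U sup cs = true)
    (m : Multiset ℕ) (hc : Multiset.card m = 4) (hm : IsHodge M m) : phi (chiF n sup) (oddVec M m) % 2 = 0 := by
  obtain ⟨a, b, c, d, hab, hbc, hcd, rfl⟩ := sorted4 m hc
  have hent := hm.2.1
  have ha := hent a (by simp)
  have hb := hent b (by simp)
  have hc' := hent c (by simp)
  have hd := hent d (by simp)
  have h1 := hm.2.2 1 (by omega) (by simp)
  have hsum : a + b + c + d = 2 * M := by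
    simp only [wt_coe, S, List.map, List.sum_cons, List.sum_nil, one_mul, Multiset.coe_card, List.length] at h1
    rw [Nat.mod_eq_of_lt ha.2, Nat.mod_eq_of_lt hb.2, Nat.mod_eq_of_lt hc'.2, Nat.mod_eq_of_lt hd.2] at h1
    omega
  by_cases hab0 : (a + b) % M = 0
  · have hab' : a + b = M := sum_eq_of_mod M (a + b) (by omega) (by omega) hab0
    have hb' : b = M - a := by omega
    have hd' : d = M - c := by omega
    subst hb' hd'
    rw [oddVec_cancel M a c ha hc' hn, map_zero]
    rfl
  simp only [checkP, Bool.and_eq_true, List.all_eq_true, List.mem_range] at h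
  obtain ⟨hA, hB⟩ := h
  have key : ∀ x y : ℕ, x ≤ y → 0 < x → x < M → 0 < y → y < M → (x + y) % M ≠ 0 →
      (∀ u ∈ U, S M u [x, y] % M ≠ 0) ∧
        find2 (cokeyP M U) cs (M * prof M U [x, y] + (x + y) % M) = some (parL M sup [x, y]) := by
    intro x y hxy hx0 hxM hy0 hyM hxy0
    have h3 := hA x hxM
    simp only [checkPa, Bool.or_eq_true, beq_iff_eq, List.all_eq_true, List.mem_range, decide_eq_true_eq] at h3
    rcases h3 with h3 | h3
    · omega
    have h4 := h3 y hyM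
    rcases h4 with (h4 | h4) | h4
    · omega
    · exact absurd h4 hxy0
    · cases hP : prof2 M U [x, y] with
      | none => simp [hP] at h4
      | some P =>
        obtain ⟨hS, hPP⟩ := prof2_some M U [x, y] P hP
        rw [hP] at h4
        simp only [beq_iff_eq] at h4
        rw [hPP]
        exact ⟨hS, h4⟩
  have hne : a + b ≠ M := by
    intro h
    rw [h, Nat.mod_self] at hab0
    exact hab0 rfl
  have hcd0 : (c + d) % M ≠ 0 := by
    intro h0
    have := sum_eq_of_mod M (c + d) (by omega) (by omega) h0
    omega
  obtain ⟨u1, f1⟩ := key a b hab ha.1 ha.2 hb.1 hb.2 hab0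
  obtain ⟨u2, f2⟩ := key c d hcd hc'.1 hc'.2 hd.1 hd.2 hcd0
  have hw : ∀ u ∈ U, S M u [a, b] + S M u [c, d] = 2 * M := by
    intro u hu
    have := hm.2.2 u (hU u hu).1 (hU u hu).2
    rw [Multiset.coe_card, wt_coe, show ([a, b, c, d] : List ℕ) = [a, b] ++ [c, d] from rfl, S_append] at this
    simp only [List.length_append, List.length_cons, List.length_nil] at this
    omega
  have hp : prof M U [a, b] + prof M U [c, d] = 2 ^ U.length - 1 :=
    prof_compl2 M U [a, b] [c, d] (fun u hu => ⟨u1 u hu, hw u hu⟩)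
  have hσ : (a + b) % M + (c + d) % M = M := by
    by_cases hle : M ≤ a + b
    · rw [Nat.mod_eq_sub_mod hle, Nat.mod_eq_of_lt (by omega), Nat.mod_eq_of_lt (by omega)]
      omega
    · rw [Nat.mod_eq_of_lt (by omega), Nat.mod_eq_sub_mod (by omega), Nat.mod_eq_of_lt (by omega)]
      omega
  have hk12 := cokeyP_eq M (by omega) U (prof M U [a, b]) (prof M U [c, d]) ((a + b) % M) ((c + d) % M) hp
    (Nat.mod_lt _ (by omega)) hσ
  have hk21 := cokeyP_eq M (by omega) U (prof M U [c, d]) (prof M U [a, b]) ((c + d) % M) ((a + b) % M) (by omega)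
    (Nat.mod_lt _ (by omega)) (by omega)
  have hpar := find2_compl (cokeyP M U) cs hB _ _ _ _ hk12 hk21 f1 f2
  have e : phi (chiF n sup) (oddVec M (([a, b, c, d] : List ℕ) : Multiset ℕ)) =
      phi (chiF n sup) (oddVec M (([a, b] : List ℕ) : Multiset ℕ)) +
        phi (chiF n sup) (oddVec M (([c, d] : List ℕ) : Multiset ℕ)) := by
    rw [show ([a, b, c, d] : List ℕ) = [a, b] ++ [c, d] from rfl, ← Multiset.coe_add, oddVec_add, map_add]
  rw [e, Int.add_emod]
  have p1 := parL_eq (n := n) M sup hnd hlt [a, b]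
  have p2 := parL_eq (n := n) M sup hnd hlt [c, d]
  rw [← p1, ← p2, hpar]
  omega

/-- THE SPLIT 6-MULTISET LEMMA: the triple check passed (U a list of units) ⇒ every Hodge 6-multiset that is the sum of two
zero-sum triples has even parity -/
theorem par6 {n : ℕ} (M : ℕ) (hM : 3 ≤ M) (U : List ℕ) (hU : ∀ u ∈ U, u < M ∧ Nat.gcd u M = 1) (sup : List ℕ)
    (hnd : sup.Nodup) (hlt : ∀ i ∈ sup, i < n) (cs : List (List ℕ)) (h : check6 M U sup cs = true) (T₁ T₂ : List ℕ)
    (h1 : T₁.length = 3) (h2 : T₂.length = 3) (hs1 : T₁.sum % M = 0) (hs2 : T₂.sum % M = 0)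
    (hm : IsHodge M ((T₁ ++ T₂ : List ℕ) : Multiset ℕ)) :
    phi (chiF n sup) (oddVec M ((T₁ ++ T₂ : List ℕ) : Multiset ℕ)) % 2 = 0 := by
  simp only [check6, Bool.and_eq_true, List.all_eq_true, List.mem_range] at h
  obtain ⟨hA, hB⟩ := h
  have key : ∀ T : List ℕ, T.length = 3 → T.sum % M = 0 → (∀ x ∈ T, 0 < x ∧ x < M) →
      ∃ T' : List ℕ, (T' : Multiset ℕ) = (T : Multiset ℕ) ∧
        (∀ u ∈ U, S M u T' = M ∨ S M u T' = 2 * M) ∧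
        find2 (cokey6 U) cs (prof M U T') = some (parL M sup T') := by
    intro T hT hsum hent
    obtain ⟨a, b, c, hab, hbc, hT'⟩ := sorted3 (T : Multiset ℕ) (by simp [hT])
    refine ⟨[a, b, c], hT'.symm, ?_⟩
    have hent' : ∀ x ∈ [a, b, c], 0 < x ∧ x < M := by
      intro x hx
      apply hent
      rw [← Multiset.mem_coe, hT', Multiset.mem_coe]
      exact hx
    have ha := hent' a (by simp)
    have hb := hent' b (by simp)
    have hc := hent' c (by simp)
    have hsum' : (a + b + c) % M = 0 := by
      have e : ([a, b, c] : List ℕ).sum = T.sum := by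
        have := congrArg Multiset.sum hT'
        simpa [Multiset.sum_coe] using this.symm
      simp only [List.sum_cons, List.sum_nil, add_zero] at e
      rw [← hsum, ← e]
      congr 1
      omega
    have hc' : (M - (a + b) % M) % M = c := mod_last M (a + b) c hc.1 hc.2 hsum'
    have h3 := hA a ha.2
    simp only [check6a, Bool.or_eq_true, beq_iff_eq, List.all_eq_true, List.mem_range, decide_eq_true_eq] at h3
    rcases h3 with h3 | h3
    · omega
    have h4 := h3 b hb.2
    rcases h4 with h4 | h4
    · omega
    rw [hc'] at h4
    rcases h4 with (h4 | h4) | h4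
    · omega
    · omega
    · cases hP : prof3 M U [a, b, c] with
      | none => simp [hP] at h4
      | some P =>
        obtain ⟨hS, hPP⟩ := prof3_some M U [a, b, c] P hP
        rw [hP] at h4
        simp only [beq_iff_eq] at h4
        rw [hPP]
        exact ⟨hS, h4⟩
  have hent : ∀ x ∈ T₁ ++ T₂, 0 < x ∧ x < M := fun x hx => hm.2.1 x (Multiset.mem_coe.mpr hx)
  obtain ⟨T₁', e1, u1, f1⟩ := key T₁ h1 hs1 (fun x hx => hent x (List.mem_append_left _ hx))
  obtain ⟨T₂', e2, u2, f2⟩ := key T₂ h2 hs2 (fun x hx => hent x (List.mem_append_right _ hx))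
  have hw : ∀ u ∈ U, S M u T₁' + S M u T₂' = 3 * M := by
    intro u hu
    have := hm.2.2 u (hU u hu).1 (hU u hu).2
    rw [Multiset.coe_card, List.length_append, h1, h2, ← Multiset.coe_add, wt_add, ← e1, ← e2, wt_coe, wt_coe] at this
    omega
  have hp : prof M U T₁' + prof M U T₂' = 2 ^ U.length - 1 :=
    prof_compl3 M (by omega) U T₁' T₂' (fun u hu => ⟨u1 u hu, hw u hu⟩)
  have hk12 : cokey6 U (prof M U T₁') = prof M U T₂' := by unfold cokey6; omega
  have hk21 : cokey6 U (prof M U T₂') = prof M U T₁' := by unfold cokey6; omega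
  have hpar := find2_compl (cokey6 U) cs hB _ _ _ _ hk12 hk21 f1 f2
  have e : phi (chiF n sup) (oddVec M ((T₁ ++ T₂ : List ℕ) : Multiset ℕ)) =
      phi (chiF n sup) (oddVec M (T₁' : Multiset ℕ)) + phi (chiF n sup) (oddVec M (T₂' : Multiset ℕ)) := by
    rw [← Multiset.coe_add, oddVec_add, map_add, e1, e2]
  rw [e, Int.add_emod]
  have p1 := parL_eq (n := n) M sup hnd hlt T₁'
  have p2 := parL_eq (n := n) M sup hnd hlt T₂'
  rw [← p1, ← p2, hpar]
  omega

/-- THE σ LEMMA: the check passed ⇒ every σ_{p,i} of the block set has even parity -/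
theorem parS {n : ℕ} (M : ℕ) (sup : List ℕ) (hnd : sup.Nodup) (hlt : ∀ i ∈ sup, i < n) (h : checkS M sup = true)
    (p i : ℕ) (hp : Nat.Prime p) (hodd : p % 2 = 1) (hdvd : M % p = 0) (hi0 : 0 < i) (hiM : i < M)
    (hg : 2 < (M / p) / Nat.gcd i (M / p)) :
    phi (chiF n sup) (oddVec M ((sigma M p i : List ℕ) : Multiset ℕ)) % 2 = 0 := by
  simp only [checkS, List.all_eq_true, List.mem_range, Bool.or_eq_true, Bool.not_eq_true', beq_iff_eq,
    decide_eq_false_iff_not] at h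
  have hpM : p < M + 1 := by
    have := Nat.le_of_dvd (by omega) (Nat.dvd_of_mod_eq_zero hdvd)
    omega
  have h1 := h p hpM
  rcases h1 with h1 | h1
  · simp [hp, hodd, hdvd] at h1
  · have h2 := h1 i hiM
    rcases h2 with (h2 | h2) | h2
    · omega
    · exact absurd hg h2
    · have := parL_eq (n := n) M sup hnd hlt (sigma M p i)
      rw [h2] at this
      simpa using this.symm

/-- THE FUNCTIONAL ARGUMENT, PART 1: the ℤ-span of vectors of even parity consists of vectors of even parity -/
theorem even_of_mem_span {n : ℕ} (chi : Fin n → ℤ) (Sset : Set (Fin n → ℤ)) (hS : ∀ v ∈ Sset, phi chi v % 2 = 0)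
    (x : Fin n → ℤ) (hx : x ∈ Submodule.span ℤ Sset) : phi chi x % 2 = 0 := by
  have key : Submodule.span ℤ Sset ≤ Submodule.comap (phi chi) (Ideal.span {(2 : ℤ)}) := by
    rw [Submodule.span_le]
    intro v hv
    rw [SetLike.mem_coe, Submodule.mem_comap, Ideal.mem_span_singleton]
    exact Int.dvd_of_emod_eq_zero (hS v hv)
  have h2 := key hx
  rw [Submodule.mem_comap, Ideal.mem_span_singleton] at h2
  obtain ⟨k, hk⟩ := h2
  omega

/-- THE FUNCTIONAL ARGUMENT, PART 2: a vector of odd parity is not in the ℤ-span of vectors of even parity -/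
theorem notin_of_parity {n : ℕ} (chi : Fin n → ℤ) (Sset : Set (Fin n → ℤ)) (hS : ∀ v ∈ Sset, phi chi v % 2 = 0)
    (x : Fin n → ℤ) (hx : phi chi x % 2 = 1) : x ∉ Submodule.span ℤ Sset := by
  intro hmem
  have := even_of_mem_span chi Sset hS x hmem
  omega

/-- the weight-constraint matrix at M: row t (a unit), column a: 2·(t·(a+1) mod M) − M -/
def conMat (M : ℕ) {u n : ℕ} (unitsF : Fin u → ℕ) : Matrix (Fin u) (Fin n) ℤ :=
  Matrix.of fun i a => 2 * (((unitsF i * (a.val + 1)) % M : ℕ) : ℤ) - (M : ℤ)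

/-- RESTRICTION: if the full weight constraints vanish on s, so do those of any initial segment of the units -/
theorem restrict_zero {u u' n : ℕ} (h : u' ≤ u) (M : ℕ) (unitsF : Fin u → ℕ) (s : Fin n → ℤ)
    (hs : conMat M unitsF *ᵥ s = 0) : conMat M (fun j : Fin u' => unitsF (Fin.castLE h j)) *ᵥ s = 0 := by
  funext j
  have := congrFun hs (Fin.castLE h j)
  simpa [conMat, Matrix.mulVec, dotProduct] using this

/-- THE ROW-SPACE LEMMA: if d·(1 − Kᵀ·W) = X·B with d ≠ 0, then every s with B·s = 0 is Kᵀ·(W·s) -/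
theorem rowspace_of_cert {n u k : ℕ} (B : Matrix (Fin u) (Fin n) ℤ) (K W : Matrix (Fin k) (Fin n) ℤ)
    (X : Matrix (Fin n) (Fin u) ℤ) (d : ℤ) (hd : d ≠ 0)
    (hc : d • ((1 : Matrix (Fin n) (Fin n) ℤ) - K.transpose * W) = X * B)
    (s : Fin n → ℤ) (hs : B *ᵥ s = 0) : s = K.transpose *ᵥ (W *ᵥ s) := by
  have h1 : (X * B) *ᵥ s = 0 := by rw [← Matrix.mulVec_mulVec, hs, Matrix.mulVec_zero]
  rw [← hc, Matrix.smul_mulVec, smul_eq_zero] at h1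
  rcases h1 with h1 | h1
  · exact absurd h1 hd
  · rw [Matrix.sub_mulVec, Matrix.one_mulVec, sub_eq_zero, ← Matrix.mulVec_mulVec] at h1
    exact h1

/-- the augmented constraint matrix: the rows of BH with a 0 appended, then the row (χ, −2) -/
def augMat {u n : ℕ} (BH : Matrix (Fin u) (Fin n) ℤ) (chi : Fin n → ℤ) : Matrix (Fin (u + 1)) (Fin (n + 1)) ℤ :=
  Matrix.of fun i j =>
    if hi : i.val < u then (if hj : j.val < n then BH ⟨i.val, hi⟩ ⟨j.val, hj⟩ else 0)
    else (if hj : j.val < n then chi ⟨j.val, hj⟩ else -2)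

/-- THE AUGMENTED CERTIFICATE LEMMA: if K (a basis of the kernel of the augmented system) projected to the first n
coordinates is C·G, and d·(1 − Kᵀ·W) = X·augMat BH χ with d ≠ 0, then every s with BH·s = 0 and φ_χ(s) even is an
integer combination of the rows of G -/
theorem generated_aug {n u k g : ℕ} (BH : Matrix (Fin u) (Fin n) ℤ) (G : Matrix (Fin g) (Fin n) ℤ)
    (K W : Matrix (Fin k) (Fin (n + 1)) ℤ) (C : Matrix (Fin k) (Fin g) ℤ) (X : Matrix (Fin (n + 1)) (Fin (u + 1)) ℤ)
    (d : ℤ) (hd : d ≠ 0) (chi : Fin n → ℤ)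
    (hK : (Matrix.of fun i (j : Fin n) => K i j.castSucc) = C * G)
    (hc : d • ((1 : Matrix (Fin (n + 1)) (Fin (n + 1)) ℤ) - K.transpose * W) = X * augMat BH chi)
    (s : Fin n → ℤ) (hs : BH *ᵥ s = 0) (hpar : phi chi s % 2 = 0) : ∃ c : Fin g → ℤ, s = G.transpose *ᵥ c := by
  have h2y : phi chi s = 2 * (phi chi s / 2) := by omega
  set y : ℤ := phi chi s / 2 with hy
  have hsy : augMat BH chi *ᵥ (Fin.snoc (α := fun _ => ℤ) s y) = 0 := by
    funext i
    refine Fin.lastCases ?_ (fun i' => ?_) i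
    · simp only [Matrix.mulVec, dotProduct, augMat, Matrix.of_apply, Pi.zero_apply, Fin.val_last, lt_irrefl,
        dite_false, Fin.sum_univ_castSucc, Fin.val_castSucc, Fin.is_lt, dite_true, Fin.eta, Fin.snoc_castSucc,
        Fin.snoc_last]
      rw [← phi_apply, h2y]
      ring
    · simp only [Matrix.mulVec, dotProduct, augMat, Matrix.of_apply, Pi.zero_apply, Fin.val_castSucc, Fin.is_lt,
        dite_true, Fin.eta, Fin.sum_univ_castSucc, Fin.val_last, lt_irrefl, dite_false, Fin.snoc_castSucc,
        Fin.snoc_last]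
      have := congrFun hs i'
      simpa [Matrix.mulVec, dotProduct] using this
  have hrow := rowspace_of_cert (augMat BH chi) K W X d hd hc _ hsy
  refine ⟨C.transpose *ᵥ (W *ᵥ (Fin.snoc (α := fun _ => ℤ) s y)), ?_⟩
  have hR : G.transpose *ᵥ (C.transpose *ᵥ (W *ᵥ (Fin.snoc (α := fun _ => ℤ) s y))) =
      (Matrix.of fun i (j : Fin n) => K i j.castSucc).transpose *ᵥ (W *ᵥ (Fin.snoc (α := fun _ => ℤ) s y)) := by
    rw [hK, Matrix.transpose_mul, Matrix.mulVec_mulVec]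
  funext j
  have hj := congrFun hrow (Fin.castSucc j)
  rw [Fin.snoc_castSucc] at hj
  rw [hj, hR]
  simp [Matrix.mulVec, dotProduct, Matrix.transpose_apply, Matrix.of_apply]

/-- a vector Gᵀ·c lies in the span of the rows of G -/
theorem mem_span_of_mulVec {n g : ℕ} (G : Matrix (Fin g) (Fin n) ℤ) (Sset : Set (Fin n → ℤ)) (hG : ∀ j, G j ∈ Sset)
    (c : Fin g → ℤ) : G.transpose *ᵥ c ∈ Submodule.span ℤ Sset := by
  rw [Matrix.mulVec_transpose, Matrix.vecMul_eq_sum]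
  exact Submodule.sum_mem _ (fun j _ => Submodule.smul_mem _ _ (Submodule.subset_span (hG j)))

/-- a listed block: kind 0 = a Hodge 4-multiset x; kind 1 = a split Hodge 6-multiset x = T₁ ++ T₂ (T₁ the first three
entries); kind 2 = σ_{p,i} -/
structure LBlock where
  kind : ℕ
  x : List ℕ
  p : ℕ
  i : ℕ

/-- the multiset of a listed block -/
def LBlock.ms (M : ℕ) (b : LBlock) : List ℕ := if b.kind == 2 then sigma M b.p b.i else b.x

/-- legitimacy of a listed block at M (the units U given) -/
def LBlock.ok (M : ℕ) (U : List ℕ) (b : LBlock) : Bool :=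
  if b.kind == 0 then b.x.length == 4 && isHodge M U b.x
  else if b.kind == 1 then
    b.x.length == 6 && (b.x.take 3).sum % M == 0 && (b.x.drop 3).sum % M == 0 && isHodge M U b.x
  else b.kind == 2 && decide (Nat.Prime b.p) && b.p % 2 == 1 && M % b.p == 0 && decide (0 < b.i) && decide (b.i < M) &&
    decide (2 < (M / b.p) / Nat.gcd b.i (M / b.p))

/-- a listed block that passes `ok` is a block -/
theorem isBlock_of_ok (M : ℕ) (b : LBlock) (h : b.ok M (unitsL M) = true) :
    IsBlock M ((b.ms M : List ℕ) : Multiset ℕ) := by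
  unfold LBlock.ok at h
  split_ifs at h with h0 h1
  · have hk : b.kind = 0 := by simpa using h0
    have hms : b.ms M = b.x := by simp [LBlock.ms, hk]
    rw [hms]
    simp only [Bool.and_eq_true, beq_iff_eq] at h
    exact Or.inl ⟨by simp [h.1], (isHodge_iff M _).mp h.2⟩
  · have hk : b.kind = 1 := by simpa using h1
    have hms : b.ms M = b.x := by simp [LBlock.ms, hk]
    rw [hms]
    simp only [Bool.and_eq_true, beq_iff_eq] at h
    obtain ⟨⟨⟨hl, ht⟩, hd⟩, hH⟩ := h
    refine Or.inr (Or.inl ⟨b.x.take 3, b.x.drop 3, by rw [List.take_append_drop], ?_, ?_, ht, hd,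
      (isHodge_iff M _).mp hH⟩)
    · simp [List.length_take, hl]
    · simp [List.length_drop, hl]
  · simp only [Bool.and_eq_true, beq_iff_eq, decide_eq_true_eq] at h
    obtain ⟨⟨⟨⟨⟨⟨hk, hp⟩, ho⟩, hd⟩, hi0⟩, hiM⟩, hg⟩ := h
    have hms : b.ms M = sigma M b.p b.i := by simp [LBlock.ms, hk]
    rw [hms]
    exact Or.inr (Or.inr ⟨b.p, b.i, hp, ho, hd, hi0, hiM, hg, rfl⟩)

/-- the matrix of the listed blocks' odd vectors (row j = the j-th block) -/
def genMat (M : ℕ) (blocks : List LBlock) (g n : ℕ) : Matrix (Fin g) (Fin n) ℤ :=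
  Matrix.of fun j a => oddVec M (((blocks.getD j ⟨0, [], 0, 0⟩).ms M : List ℕ) : Multiset ℕ) a

/-- every row of the generator matrix of legitimate listed blocks is the odd vector of a block -/
theorem genMat_mem (M : ℕ) (blocks : List LBlock) (g n : ℕ)
    (hok : ∀ j : Fin g, (blocks.getD j ⟨0, [], 0, 0⟩).ok M (unitsL M) = true) (j : Fin g) :
    genMat M blocks g n j ∈ (oddVec (n := n) M) '' {m | IsBlock M m} :=
  ⟨_, isBlock_of_ok M _ (hok j), rfl⟩

end HodgeRepro0.P1.P1LatticeIndexTwoExact
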